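import Summits.Parity.GeneralizedHardyLittlewood.Theorems.BeyondDiagonalBeatsQuarter.OffDiagonalControl

/-!
# Line `fixed-level-kloosterman` (D-0130 Strategy B) — crux K_B
`PrimeLevelFamEdge.BeyondDiagonalBeatsQuarter` (stmt-Parity-20343, rev 3)

STRATEGY B (director-frontier 2026-08-27T11:45:43Z; ls-lead WORDS #10 S1–S4): settle the heart
inequality `second + T₂ < 2·lin²` at a FIXED prime level `q` by an analytic estimate of the
Kloosterman–Bessel (off-diagonal) part of the mollified second moment
`Q^h(P,1) = Σʰ_f |Λ(f,½) M_P(f)|²` with mollifier `M = q̂^{Δ'}`, `Δ'` just above the diagonal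
`Δ' = 1` (`M² = q̂² ≍ q`), from Petersson's formula at prime level WITH its printed range
(`KowalskiMichel2000.kowalskiMichel2000_peterssonFormula` / `…_peterssonBound`, R2-G44 — never the
refuted `kowalskiMichel2000_petersson`), Weil's bound for `S(m,n;qr)` and the size of `J₁`.

SKELETON. ONE analytic stub, no costume of K_B / HEART / S2u (S1), no Petersson binder at all (S2),
window and slack existential (S3):
* OD `stub_offDiagonalControl_X_sq` — OPEN (XL; = registry famE-02 at the profile `X²`): on an
  initial segment `(1, b)`, `b ≤ 3/2`, the true `Q^h(X², 1; q̂^{Δ'})` stays, for all large primes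
  with KMV's guard `q̂^{Δ'} ∉ ℕ`, within `2ζ(2)² q̂/(Δ'² log² q̂)·U(Δ') + O(q̂ log⁻³ q̂)` of the
  DIAGONAL-SHAPE main term `2ζ(2)² q̂/(Δ'² log² q̂)·(4 + 4/Δ')` (`secondMomentForm Δ' X² 1`), with
  slack `U(Δ') < 4(Δ'−1)/Δ' = 2·lin² − second`. Inside it sit the line's two analytic claims:
  (OD-a) the diagonal (`δ`) part of Petersson keeps KMV's shape (31) beyond `Δ' = 1`
  [KowalskiMichelVanderKam2000, §5, Prop. 5.1]; (OD-b) the Kloosterman–Bessel part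
  `Σ_{m,n} c_m c̄_n · J(m,n)`, `J(m,n) = (2π/q) Σ_r r⁻¹ S(m,n;qr) J₁(4π√(mn)/(qr))`
  [KowalskiMichel2000, §2.4.2 p. 312], is `< slack` in the same scale. The cheapest falsifier is
  bed-4 (D-0130): `‖Q^h_emp − model‖/scale` against `4(Δ'−1)/Δ'` at 17 prime levels (S4).
* `BeyondDiagonalBeatsQuarter_of` — KERNEL-PROVED composition (Theorems
  `BeyondDiagonalBeatsQuarter/OffDiagonalControl`, this line): OD pins `|T₂ Δ' X² 1| ≤ U(Δ')` for
  every MA-consistent `(T₁,T₂)` (uniqueness of the second display along good primes,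
  `goodPrimesUnbounded_of_lt_two`), Bettin's printed first moment (the crux's antecedent) pins
  `T₁ = 0`, and `0 < 8/Δ' ≤ 4 + 4/Δ' + T₂ < 8 = 2·lin²` is value `> ¼` on `(1, min b Δ)`.
  Positivity comes from the two-sided control, so the Cauchy–Schwarz floor (and with it every
  Petersson input) is not needed; the one-sided variant «upper control only» would compose through
  `Theorems….beyondDiagonalBeatsQuarter_of_upperSomewhere_X_sq` (p527867) once its R2-G44 twin lands.
PRICE (honest, ls-lead WORDS #10): OD is the second mollified moment beyond the diagonal at one
level — KMV's own words put Weil's bound at `Δ < 1/2` (Lemma 3.2) and the [I-S]/[VdK2] off-diagonal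
treatment at `Δ < 1` (Lemma 3.3, Prop. 5.1); nothing in print reaches `Δ' > 1` at a fixed level.
«The programme SEARCHES and TYPES; no claim about Landau–Siegel zeros, Theorems 1–2 of
arXiv:2211.02515 or a repaired Margin232 until a kernel theorem says so.»
-/

open Polynomial

namespace Summit.Parity.GeneralizedHardyLittlewood.Cruxes.BeyondDiagonalBeatsQuarter.FixedLevelKloosterman

open Literature.NumberTheory.LFunctions
open Literature.NumberTheory.LFunctions.KMV2000
open Summit.Parity.GeneralizedHardyLittlewood.Theses.PrimeLevelFamEdge

/-- stub OD (XL, OPEN — THE off-diagonal lemma of Strategy B, typed over existing decls): two-sided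
control of the mollified second moment at the profile `X²`, `Q = 1`, just beyond the diagonal. For
some `b ∈ (1, 3/2]` and every `Δ' ∈ (1, b)` there are `U < 4(Δ'−1)/Δ'` (the diagonal slack
`2·lin² − second` at `X²`), `C` and `q₁` with, for all primes `q ≥ q₁` such that `q̂^{Δ'} ∉ ℕ`,
`‖Q^h(X²,1; q̂^{Δ'}) − 2ζ(2)² q̂/(Δ'² log² q̂)·(4 + 4/Δ')‖ ≤ 2ζ(2)² q̂/(Δ'² log² q̂)·U + C q̂ log⁻³ q̂`
— i.e. the diagonal part keeps KMV's shape (31) and the Kloosterman–Bessel part of Petersson's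
formula (Weil + `|J₁(x)| ≤ x/2`) is below the slack, at a FIXED level.
[cite: KowalskiMichelVanderKam2000, Prop. 5.1 (31), Lemma 3.2 (12), Lemma 3.3]
[cite: KowalskiMichel2000, §2.4.2 p. 312 (Petersson's formula, (23))] -/
theorem stub_offDiagonalControl_X_sq :
    ∃ b : ℝ, 1 < b ∧ b ≤ 3 / 2 ∧ ∀ Δ' : ℝ, 1 < Δ' → Δ' < b →
      ∃ U C : ℝ, U < 4 * (Δ' - 1) / Δ' ∧ ∃ q₁ : ℕ, ∀ (q : ℕ) [NeZero q], q.Prime → q₁ ≤ q →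
        (∀ n : ℕ, (n : ℝ) ≠ qhat q ^ Δ') →
          ‖QhPQ q (X ^ 2) 1 (qhat q ^ Δ') -
              ((2 * riemannZeta 2 ^ 2 * ((qhat q / (Δ' ^ 2 * Real.log (qhat q) ^ 2) : ℝ) : ℂ)) *
                ((secondMomentForm Δ' (X ^ 2) 1 : ℝ) : ℂ))‖ ≤
            2 * (Real.pi ^ 2 / 6) ^ 2 * (qhat q / (Δ' ^ 2 * Real.log (qhat q) ^ 2)) * U +
              C * qhat q * (Real.log (qhat q))⁻¹ ^ 3 := by
  sorry

/-- **Composition (kernel-checked): OD gives the rev-3 crux**, through the landed Theorems-side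
reduction `beyondDiagonalBeatsQuarter_of_offDiagonalControl_X_sq` (window `(1, min b Δ)`, profile
`X²`; Bettin pins `T₁ = 0`, OD pins `|T₂| ≤ U < 4(Δ'−1)/Δ'`; no Petersson input).
[cite: KowalskiMichelVanderKam2000, Thm. 6.1 (30)–(32)] [cite: Bettin2017, Thm. 1.1] -/
theorem BeyondDiagonalBeatsQuarter_of :
    Summit.Parity.GeneralizedHardyLittlewood.Theses.PrimeLevelFamEdge.BeyondDiagonalBeatsQuarter :=
  Theorems.BeyondDiagonalBeatsQuarter.beyondDiagonalBeatsQuarter_of_offDiagonalControl_X_sq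
    stub_offDiagonalControl_X_sq

end Summit.Parity.GeneralizedHardyLittlewood.Cruxes.BeyondDiagonalBeatsQuarter.FixedLevelKloosterman
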